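import Literature.MathematicalPhysics.QuantumFieldTheory.Balaban1983to89.B8DentedCubeMemberTorusSizeLines
import Literature.MathematicalPhysics.QuantumFieldTheory.Balaban1983to89.B8Prop3MultiLevelTorusP26L0

/-!
# `Balaban1983to89.B8Ineq159FlatDentedCubeMemberTransplant` — [Balaban1985RegularSpaces] (1.59) p. 86 AT `U₀ = 1` ON THE DENTED CUBE MEMBER `{Ω′_j}` OF
# [Balaban1985Variational] (148)–(150), AVERAGING DATUM OVER PRINT's CLASS — THE NAMED FACT `B8Ineq159FlatDentedCubeMemberPrinted.Ineq159FlatDentedCubeMemberPrinted (d+1) (ℓ+1)`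
# PROVED for every odd `L = ℓ + 1 ≥ 5`, by TRANSPLANT to lit-balaban's level-0 torus reading `B8Prop3MultiLevelTorusP26L0.prop3_multiLevelTorus_V1_P26_vector` ([4] Thm 3.3 at
# `U = 1` ⟸ [B6] Prop. 2.6 on the k-level torus WITH `Λ₀`) at the dented member `B8CubeMemberTorusDomainsDented.cubeTDomainsDented`

statement-level skeleton of published theorems with citation tags; proofs where landed; nothing here is a claim about the
Yang–Mills mass gap

`[Balaban1985RegularSpaces]` ("B8" = [6], CMP **99** (1985) 75–102) (1.59) p. 86, (1.62) p. 87, (1.31) p. 82, (1.38) p. 82, (1.131)–(1.132) p. 99, p. 98, (1.3)–(1.4) p. 77;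
`[Balaban1985Variational]` ("[15]", CMP **102** (1985) 277–309) (148)–(152) p. 301, p. 300; `[Balaban1985BackgroundPropagators]` ([4], CMP **99** (1985) 389–434) Thm 3.3 p. 399,
(3.47) p. 398; `[Balaban1984PropagatorsII]` ("B6", CMP **96** (1984) 223–250) Prop. 2.6 (2.136) p. 247, (2.1)–(2.3) p. 224, (2.12) p. 225.  PDF held:
`paper:balaban1985-cmp99-regular-spaces-gauge-fixing`, `paper:balaban1985-cmp102-variational-background`, `paper:balaban1984-cmp96-propagators-rt-ii`.

CITATION HEADER (lean-in-tree rule).  Cell `pub-ymgap` (YM Track A, HUMAN RULING D-0062), DAG node N05 = [B8], seat `pub-ymgap-dag-n05-e` (g32; FAN-OUT §N05 row s3b,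
Proposition-6 lane; piece (d2-c) of the (β) road: dag-n05-c PRICE I.41357 (2) «(d2) … the dented transplant», STANDING GO I.42366; this seat INTENT I.43297).
WHY THIS FILE.  The (β) road's crown `B8Prop6DentedCubeMemberScalarGammaOfGBound.gaugedBoundB8D_dentedMember_scalar_γ_of_gboundDented` (this seat g31, p670304) lands [6]
Proposition 6's conclusion as NODE 00's `GaugedBoundB8D` at every DENTED cube member of print's sub-lattice CONDITIONALLY on four named facts, the first of which is
`h159D : Ineq159FlatDentedCubeMemberPrinted d L` (p659892) = [6] (1.59) ∕ [4] Thm 3.3 at `U₀ = 1` on [15]'s dented sequence `{Ω′_j}` at its top truncation.  dag-n05-c's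
`B8Ineq159FlatCubeMemberTransplant.ineq159FlatCubeMemberPrinted_holds` proves the PURE twin by transplant to the level-0 torus reading, which is generic in the domain datum
`D : TDomains`; this seat's g31 file `B8CubeMemberTorusDomainsDented` built the dented `D` and files 1–3 of this unit (`B8DentedCubeMemberTorus{Classes,Landau,SizeLines}`)
re-read the transplant's dictionaries on it.  THIS FILE is the transplant itself — ONE theorem, dag-n05-c's proof with the dented suppliers and the one extra premise of the
dented fact («`Ω_k` is a union of `M₁Lᵏ`-cubes of the grid anchored at `□_k`'s corner», turned into `cubeTDomainsDented`'s chart-frame premise by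
`B8CubeMemberTorusDomainsDented.hΩ_of_anchored`).

WHAT THIS FILE PROVES (kernel-checked).  ★★★ `ineq159FlatDentedCubeMemberPrinted_holds (d ℓ) (hℓ : 4 ≤ ℓ) (hodd : Odd (ℓ + 1)) : Ineq159FlatDentedCubeMemberPrinted (d + 1) (ℓ + 1)` —
the named fact of p659892 for every odd `L ≥ 5` and every `d + 1 ≥ 1`, with the PURE transplant's thresholds: `M₀ := max (8L) M₄` (`M_h = Lˢ ≥ 8`, `M₄ ≤ L^{s+1}`), `R₀ := 2L²`,
`N₀ := 0`, `ρ₀ := 1`, `B₀ := 2L³·5K·(8(d+1)+1)-type constant of the reading `+ 1`.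
HONEST SCOPE: odd `L ≥ 5` only (the V1 torus of the reading); the analytic input is lit-balaban's hypothesis-free level-0 torus reading (r05∕p38∕r03 lineage), NOT re-proved
here; nothing of [4]∕[6]∕[15] asserted beyond it; count-neutral until the chair books; N05 ∕ N07 NOT discharged; one finite `T⁴` programme at fixed `ε`, Bałaban as printed;
nothing continuum ∕ ℝ⁴ ∕ OS ∕ mass-gap ∕ Clay.  No `sorry`, no `def`, no `instance`, no `notation`.  Unit `pub-ymgap-dag-n05-e` (g32), 2026-08-28.

RELATED IN THE TREE, NOT DUPLICATED (`rg -l 'FlatDentedCubeMemberTransplant' Balaban1983to89` = 0, 2026-08-28T22:05Z): `B8Ineq159FlatCubeMemberTransplant` (dag-n05-c g12; the PURE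
twin — the model of this file, its private plumbing re-declared privately), `B8Ineq159FlatDentedCubeMemberPrinted` (this seat g31; the TARGET, USED), `B8CubeMemberTorusDomainsDented`
(g31; `cubeTDomainsDented`, `hΩ_of_anchored` USED), files 1–3 of this unit (USED), `B8Prop3MultiLevelTorusP26L0.prop3_multiLevelTorus_V1_P26_vector` (lit-balaban; THE READING, USED).
-/
noncomputable section

namespace Literature.MathematicalPhysics.QuantumFieldTheory.Balaban1983to89.B8Ineq159FlatDentedCubeMemberTransplant

open B7Prop1Explicit (e e_apply)
open B7Prop1Local (InBox)
open B8Ineq132 (covDerivFwd covDeriv BondTouches PlaqTouches)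
open B8Eq146AExpansion (plaqCovDeriv iEta)
open B8Eq155JBound (Jcur)
open B8Eq138LandauZd (covLap covDivB)
open B8Eq140Level (SideTouches IsSide)
open B8FlatOperatorsTranslateLocal (near_of_sideTouches)
open B8CubeMemberTorusSizeLines (exists_bound_of_near deepSupp_translate box_of_near_cube_zero globalBand_weights DV_liftB_translate laplace_liftB_translate)
open B8DentedCubeMemberTorusSizeLines (exists_near_of_ne_zero le_levD_translate_add_one abs_dcsE_dcE_liftB_le abs_QE_liftB_le)
open B4Reflection242 (boxDom mem_boxDom blk)
open B6MultiLevelBoxOperator (N0 bigSide)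
open B6GlobalChartV1 (PV toBox toBox_apply)
open B6GlobalChartV1L0 (domT blkV1)
open B6SectAOperatorsV1 (dcE dcsE dsE QE RE QE_apply)
open BalabanImbrieJaffe1984to88.BIJ85AxialPropagator411 (BondSpace)
open B6GradLegKLevelV1 (DV)
open B6CubeWindowV1 (GlobalBand)
open LatticeFieldCalculus (laplace bondAvgIter)
open B8Eq131Cubes (cube sqLo sqHi inLo inHi)
open B8Eq131CubesAdmissible (cubeFam cubeFam_false_of_le cubeFam_false_zero)
open B8CubeMemberBoxDomains (shift boxP collar_gap)
open B8CubeMemberTorusDomainsL0 (torP torP_apply N0_torP_eq_sitesPerDir exists_torP_ge siteDeep_shift_of_mem_cube_zero)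
open B8CubeMemberTorusDomainsDented (cubeTDomainsDented levD hΩ_of_anchored)
open B8CubeMemberTorusChart (toTorus labels labels_toTorus DeepSupp liftB liftB_apply DV_liftB laplace_liftB dcsE_dcE_liftB)
open B8CubeMemberTorusAverages (labelsJ labelsJ_zero)
open B8DentedCubeMemberTorusClasses (len_blkV1_member)
open B8DentedCubeMemberTorusLandau (RE_dsE_liftB_eq_zero)
open B8Ineq159FlatDentedCubeMemberPrinted (Ineq159FlatDentedCubeMemberPrinted)
open B8Eq138LandauZd (IsLandau138)
open B7Prop4GeneralLevels (linCovIter linCovIter_zero)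
open B8Prop3MultiLevelTorusP26L0 (prop3_multiLevelTorus_V1_P26_vector)
open Node00 (CubeB8D)
open Literature.MathematicalPhysics.QuantumLattice (blockMap)

variable {d : ℕ}

/-! ## The transplant -/

section Main

/-- `|g z| ≤ ‖z‖` for `g = re` (private plumbing, as in the pure twin). [folklore] [cite: Balaban1984PropagatorsII, (2.136) p.247, dictionary] -/
private theorem abs_reLm_le (z : ℂ) : |Complex.reLm z| ≤ ‖z‖ := by simpa using Complex.abs_re_le_norm z

/-- `|g z| ≤ ‖z‖` for `g = im` (private plumbing, as in the pure twin). [folklore] [cite: Balaban1984PropagatorsII, (2.136) p.247, dictionary] -/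
private theorem abs_imLm_le (z : ℂ) : |Complex.imLm z| ≤ ‖z‖ := by simpa using Complex.abs_im_le_norm z

/-- `‖z‖ ≤ |re z| + |im z|` (private plumbing, as in the pure twin). [folklore] [cite: Balaban1984PropagatorsII, (2.136) p.247, dictionary] -/
private theorem norm_le_re_add_im (z : ℂ) : ‖z‖ ≤ |Complex.reLm z| + |Complex.imLm z| := by
  simpa using Complex.norm_le_abs_re_add_abs_im z

/-- ★★★ **[B8] (1.59) AT `U₀ = 1` ON THE DENTED CUBE MEMBER `{Ω′_j}` OF [15] (148)–(150), TOP TRUNCATION, AVERAGING DATUM OVER PRINT's CLASS — PROVED for every odd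
`L = ℓ + 1 ≥ 5`** (the named fact `B8Ineq159FlatDentedCubeMemberPrinted.Ineq159FlatDentedCubeMemberPrinted (d+1) (ℓ+1)` of p659892; = [4] Thm 3.3 at `U = 1` with Dirichlet
exterior on `□₀`, for the sequence `Ω′₀ = □₀ ⊃ … ⊃ Ω′_{k−1} = □_{k−1} ⊃ Ω′_k = □_k ∩ Ω_k`).  TRANSPLANT (dag-n05-c's proof of the pure twin, re-keyed): the member's field,
translated by `t` and zero-extended, is a bond function on lit-balaban's V1 torus `T_η` (period `2L^{k+1+s+e}`) carrying the level-0 family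
`(T, t+□₁, …, t+□_{k−1}, t+(□_k ∩ Ω_k))` (`B8CubeMemberTorusDomainsDented.cubeTDomainsDented`, its chart-frame premise supplied from the fact's anchored premise by
`hΩ_of_anchored`); its `∂*∂`, `∇`, `Δ`, `Q_j` read the member's `J`, `D^η_1`, `Δ^η_1`, `Lʲη·Q_j∕Lʲ`, its constraint class `𝔅` is print's `CubeB8D.lamBP`
(`B8DentedCubeMemberTorusClasses`), its Landau condition is the member's (`B8DentedCubeMemberTorusLandau`); the torus reading `prop3_multiLevelTorus_V1_P26_vector` ([B6] Prop. 2.6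
hypothesis-free at level 0) is applied with `α₂ = 0` to the real and to the imaginary part (`B8DentedCubeMemberTorusSizeLines.abs_dcsE_dcE_liftB_le ∕ abs_QE_liftB_le` are
its two size lines).  Thresholds as the pure twin: `M₀ := max (8L) M₄`, `R₀ := 2L²`, `N₀ := 0`, `ρ₀ := 1`; `B₀ := 2L³·KB·(8(d+1)+1) + 1`.
HONEST SCOPE: odd `L ≥ 5`; count-neutral; nothing continuum ∕ ℝ⁴ ∕ OS ∕ mass-gap ∕ Clay.
[cite: Balaban1985RegularSpaces, (1.59) p.86, (1.62) p.87, (1.31) p.82, (1.38) p.82, (1.131)–(1.132) p.99, p.98, (1.4) p.77; Balaban1985Variational, (148)–(152) p.301, p.300;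
Balaban1985BackgroundPropagators, Thm 3.3 p.399, (3.47) p.398; Balaban1984PropagatorsII, Prop. 2.6 (2.136) p.247, (2.1)–(2.3) p.224, (2.12) p.225] -/
theorem ineq159FlatDentedCubeMemberPrinted_holds (d ℓ : ℕ) (hℓ : 4 ≤ ℓ) (hodd : Odd (ℓ + 1)) : Ineq159FlatDentedCubeMemberPrinted (d + 1) (ℓ + 1) := by
  classical
  have hd : 1 ≤ d + 1 := Nat.succ_pos d
  have hL : Odd (ℓ + 1) ∧ 1 < ℓ + 1 := ⟨hodd, by omega⟩
  have hℓ1 : 1 ≤ ℓ := le_trans (by norm_num) hℓ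
  have hL1 : 1 ≤ ℓ + 1 := Nat.succ_pos ℓ
  have hLr : (1 : ℝ) ≤ (ℓ : ℝ) + 1 := by have : (0 : ℝ) ≤ ℓ := Nat.cast_nonneg _; linarith
  -- the reading's constants (band `b₀ = b₁ = 1`, rate `σ₀`, budget `α = 1/2`)
  obtain ⟨σ₀, hσ₀, h1⟩ := prop3_multiLevelTorus_V1_P26_vector d ℓ hd hL (b₀ := 1) (b₁ := 1) one_pos le_rfl
  obtain ⟨B₀, KL, hB₀, hKL, Amaj, M₄, hA, hM₄, hEnd⟩ := h1 σ₀ hσ₀ le_rfl (1 / 2) (by norm_num) (by norm_num)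
  clear h1
  obtain ⟨KB, hKB⟩ : ∃ KB : ℝ, KB = 5 * 1 * 1 * (KL * ((B₀ * Amaj + 1) * (1 + 2 * 1))) := ⟨_, rfl⟩
  have hKB0 : 0 ≤ KB := by rw [hKB]; positivity
  obtain ⟨cD, hcD⟩ : ∃ cD : ℝ, cD = 8 * ((d : ℝ) + 1) + 1 := ⟨_, rfl⟩
  have hcD0 : 0 ≤ cD := by rw [hcD]; positivity
  refine ⟨2 * ((ℓ : ℝ) + 1) ^ 3 * KB * cD + 1, 1, max (8 * ((ℓ : ℝ) + 1)) M₄, 0, 2 * (ℓ + 1) ^ 2, by positivity, ?_⟩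
  intro η hη K Ω c s R hM0 hρdiv hMdiv hRρ hR0 _hN0 hρ1 hanch φ hLan hsuppφ N hN0 hJ hQ hout j hjm y τ hside
  push_cast at hJ ⊢
  -- ### the member's parameters in the reading's currency (`M_h = Lˢ`, truncation `n = k`)
  have hMhL : (ℓ + 1) ^ s * (ℓ + 1) = (ℓ + 1) ^ (s + 1) := (pow_succ _ _).symm
  have hM0' : max (8 * ((ℓ : ℝ) + 1)) M₄ ≤ ((ℓ : ℝ) + 1) * ((ℓ : ℝ) + 1) ^ s := by
    rw [← pow_succ']; have h := hM0; push_cast at h; exact h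
  have hMh8 : 8 ≤ (ℓ + 1) ^ s := by
    have h8 : ((ℓ : ℝ) + 1) * 8 ≤ ((ℓ : ℝ) + 1) * ((ℓ : ℝ) + 1) ^ s := by
      rw [mul_comm _ (8 : ℝ)]; exact le_trans (le_max_left _ _) hM0'
    have h8' : (8 : ℝ) ≤ ((ℓ : ℝ) + 1) ^ s := le_of_mul_le_mul_left h8 (by positivity)
    exact_mod_cast h8'
  have hMh2 : 2 ≤ (ℓ + 1) ^ s := le_trans (by norm_num) hMh8
  have hMh1 : 1 ≤ (ℓ + 1) ^ s := le_trans (by norm_num) hMh2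
  have hM4 : M₄ ≤ ((ℓ : ℝ) + 1) * (((ℓ + 1) ^ s : ℕ) : ℝ) := by push_cast; exact le_trans (le_max_right _ _) hM0'
  have hρpos : 0 < c.ρ := by exact_mod_cast (show (0 : ℝ) < c.ρ by linarith)
  have hρ' : (ℓ + 1) ^ s * (ℓ + 1) ∣ c.ρ := by rw [hMhL]; exact hρdiv
  have hM' : (ℓ + 1) ^ s * (ℓ + 1) ∣ c.M := by rw [hMhL]; exact hMdiv
  have hR' : R * ((ℓ + 1) ^ s * (ℓ + 1)) ≤ c.ρ := by rw [hMhL]; exact hRρ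
  have hρL : ℓ + 1 ≤ c.ρ := c.L_le_ρ
  have hsq : 4 ≤ (ℓ + 1) ^ 2 := by
    calc 4 = 2 ^ 2 := by norm_num
      _ ≤ (ℓ + 1) ^ 2 := Nat.pow_le_pow_left (by omega) 2
  have hρ2L2 : 2 * (ℓ + 1) ^ 2 ≤ c.ρ := by
    have h1 : R ≤ R * ((ℓ + 1) ^ s * (ℓ + 1)) := Nat.le_mul_of_pos_right _ (by positivity)
    omega
  have hρ3 : 3 ≤ c.ρ := by omega
  have hρ8 : 8 ≤ c.ρ := by omega
  have hk1 := c.one_le_k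
  -- ### the dent premise in the chart's frame («Ω_k is a sum of cubes of a size M₁Lᵏη», M₁ = M_hL)
  have hB : (ℓ + 1) ^ (s + 1) * (ℓ + 1) ^ c.k = bigSide ℓ ((ℓ + 1) ^ s) c.k := by
    simp only [bigSide]; ring
  have hΩc := hΩ_of_anchored (Mh := (ℓ + 1) ^ s) hMh1 c (by rw [← hB]; exact hanch)
  -- ### the host torus `T_η`, period `2L^{k+1+s+e}`
  obtain ⟨e, -, heB⟩ := exists_torP_ge hℓ1 (max (boxP ℓ c.M c.ρ c.k c.k (0 : Fin (d + 1))) (5 * (ℓ + 1)))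
  have hfit : ∀ μ, boxP ℓ c.M c.ρ c.k c.k μ ≤ torP (d := d) ℓ e μ := fun μ => by
    rw [torP_apply]; exact le_trans (le_max_left _ _) heB
  have hP5 : ∀ μ, 5 * (ℓ + 1) ≤ torP (d := d) ℓ e μ := fun μ => by rw [torP_apply]; exact le_trans (le_max_right _ _) heB
  have hN := N0_torP_eq_sitesPerDir (d := d) ℓ s c.k e (c.k + 1 + s + e) 0 hd hL (by omega)
  have hk' : c.k ≤ (c.k + 1 + s + e) + 0 := by omega
  -- ### the translated field `ψ = φ(· − t)`: deep support, global bound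
  have hsupp0 : ∀ z τ', φ z τ' ≠ 0 → ∃ s' ∈ cube (ℓ + 1) c.a c.M c.ρ c.k 0, ∀ i, |z i - s' i| ≤ 1 :=
    fun z τ' hz => exists_near_of_ne_zero c hsuppφ hz
  have hψdeep := deepSupp_translate (mV := c.k + 1 + s + e) (KV := 0) (hd := hd) (hL := hL) hℓ1 hMh2 c.a c.one_le_k le_rfl hfit hN hsupp0
  have hLm1 : 1 ≤ (ℓ + 1) ^ c.k := Nat.one_le_pow _ _ hL1
  have hρm8 : 8 * (ℓ + 1) ^ c.k ≤ c.ρ * (ℓ + 1) ^ c.k := Nat.mul_le_mul_right _ hρ8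
  have hρm8z : 8 * (((ℓ + 1) ^ c.k : ℕ) : ℤ) ≤ ((c.ρ * (ℓ + 1) ^ c.k : ℕ) : ℤ) := by exact_mod_cast hρm8
  have hLm1z : (1 : ℤ) ≤ (((ℓ + 1) ^ c.k : ℕ) : ℤ) := by exact_mod_cast hLm1
  have hr2 : (2 : ℤ) ≤ ((c.ρ * (ℓ + 1) ^ c.k : ℕ) : ℤ) - 2 := by omega
  have hr1 : (1 : ℤ) ≤ ((c.ρ * (ℓ + 1) ^ c.k : ℕ) : ℤ) - 2 := by omega
  have hrLm : (((ℓ + 1) ^ c.k : ℕ) : ℤ) ≤ ((c.ρ * (ℓ + 1) ^ c.k : ℕ) : ℤ) - 2 := by omega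
  -- the side bond's nearest point of `Ω′_j ⊂ □₀`
  obtain ⟨⟨s₀, hs₀, hclose₀⟩, -⟩ := near_of_sideTouches hside
  have hs₀0 : s₀ ∈ cube (ℓ + 1) c.a c.M c.ρ c.k 0 := B8Eq131Cubes.cube_anti (Nat.zero_le j) hjm (c.sq_subset_cube hjm hs₀)
  have hybox := box_of_near_cube_zero (mV := c.k + 1 + s + e) (KV := 0) (hd := hd) (hL := hL) hℓ1 hMh2 c.a c.one_le_k le_rfl hρpos hfit hN hs₀0 hclose₀
  have hrN : ((c.ρ * (ℓ + 1) ^ c.k : ℕ) : ℤ) - 2 ≤ ((PV d ℓ (c.k + 1 + s + e) 0 hd hL).sitesPerDir 0 : ℕ) := by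
    have hdeep := siteDeep_shift_of_mem_cube_zero hℓ1 hMh2 c.a c.one_le_k le_rfl hfit hs₀0 (0 : Fin (d + 1))
    rw [hN 0] at hdeep
    linarith [hdeep.1, hdeep.2]
  have h2N : (2 : ℤ) ≤ ((PV d ℓ (c.k + 1 + s + e) 0 hd hL).sitesPerDir 0 : ℕ) := hr2.trans hrN
  have h1N : (1 : ℤ) ≤ ((PV d ℓ (c.k + 1 + s + e) 0 hd hL).sitesPerDir 0 : ℕ) := hr1.trans hrN
  have hψ2 := hψdeep.mono hr2
  have hψ1 := hψdeep.mono hr1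
  obtain ⟨Mφ, hMφ0, hMφ⟩ := exists_bound_of_near c.a hsupp0
  -- ### the lattice factor `c′ = η⁻¹` and the weights
  have hcf : η⁻¹ ≠ 0 := inv_ne_zero hη.ne'
  have hcfinv : |η⁻¹|⁻¹ = η := by rw [abs_of_pos (inv_pos.2 hη), inv_inv]
  obtain ⟨w, hw, hwb⟩ := globalBand_weights
    (Dm := domT hN (cubeTDomainsDented (d := d) hℓ1 hMh2 c hρ' hM' hR' (torP ℓ e) hfit hΩc) hk') hη
  -- ### the side bond read on the torus: `b₀ = ⟨toTorus (y + t), τ⟩`, of level `lev ≥ j − 1`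
  have hlab : labels (toTorus (hd := hd) (hL := hL) (mV := c.k + 1 + s + e) (KV := 0) (ℓ := ℓ) (y + shift ℓ ((ℓ + 1) ^ s) c.a c.ρ c.k c.k)) =
      y + shift ℓ ((ℓ + 1) ^ s) c.a c.ρ c.k c.k := labels_toTorus hybox
  obtain ⟨lev, hlev⟩ : ∃ lev : ℕ, lev = levD ((ℓ + 1) ^ s) c (y + shift ℓ ((ℓ + 1) ^ s) c.a c.ρ c.k c.k) := ⟨_, rfl⟩
  have hjlev : j ≤ lev + 1 := by
    rw [hlev]; exact le_levD_translate_add_one c hjm hs₀ hclose₀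
  have hlen : (B6Geom246MultiLevelTorusL0.geomT (cubeTDomainsDented (d := d) hℓ1 hMh2 c hρ' hM' hR' (torP ℓ e) hfit hΩc)).len
      (blkV1 hN (cubeTDomainsDented (d := d) hℓ1 hMh2 c hρ' hM' hR' (torP ℓ e) hfit hΩc)
        (⟨toTorus (y + shift ℓ ((ℓ + 1) ^ s) c.a c.ρ c.k c.k), τ⟩ : PBond (PV d ℓ (c.k + 1 + s + e) 0 hd hL) 0)) = ((ℓ : ℝ) + 1) ^ lev := by
    rw [len_blkV1_member, hlab, ← hlev]
  -- ### THE READING, applied to `g ∘ ψ` for `g = re, im`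
  have key : ∀ g : ℂ →ₗ[ℝ] ℝ, (∀ z, |g z| ≤ ‖z‖) →
      |g (φ y τ)| ≤ KB * (cD * N) * ((((ℓ : ℝ) + 1) ^ lev * η) ^ 1)⁻¹ ∧
      (∀ ν, |g (covDerivFwd η (1 : (Fin (d + 1) → ℤ) → Fin (d + 1) → ℂˣ) ν (fun z => φ z τ) y)| ≤
        KB * (cD * N) * ((((ℓ : ℝ) + 1) ^ lev * η) ^ 2)⁻¹) ∧
      |g (covLap η (1 : (Fin (d + 1) → ℤ) → Fin (d + 1) → ℂˣ) (fun z => φ z τ) y)| ≤ KB * (cD * N) * ((((ℓ : ℝ) + 1) ^ lev * η) ^ 3)⁻¹ := by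
    intro g hg
    -- Landau, the two size lines
    have h42 := RE_dsE_liftB_eq_zero hℓ1 hMh2 c hρ' hM' hR' hfit hΩc hN hk' hLan hψ2 h2N g
    have hJsize := abs_dcsE_dcE_liftB_le hℓ1 hMh2 c hρ' hM' hR' hfit hΩc hN hη hN0 hρ3 hJ (hQ 0 (Nat.zero_le _)) hout hψ2 h2N g hg
    have hBsize := abs_QE_liftB_le hℓ1 hMh2 c hρ' hM' hR' hfit hΩc hN hk' hη hQ hout hrLm hrN hψdeep hMφ0 hMφ g hg
    -- the reading at `α₂ := 0`, `dP = LP := 1`, `C₂ := 0`, `α₀ := nJ/2`, `α₁ := nB/2`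
    have hX := hEnd (c.k + 1 + s + e) 0 hN _ hk' c.one_le_k rfl hMh8 hR0 hP5 hℓ hM4 hcf hw hwb _ _ _ rfl h42 rfl
      ((16 * ((d : ℝ) + 1) + 1) * N) N (mul_nonneg (by positivity) hN0) hN0 hJsize hBsize 1 1 0 (((16 * ((d : ℝ) + 1) + 1) * N) / 2) (N / 2) 0
      (by norm_num) (by norm_num) (div_nonneg (mul_nonneg (by positivity) hN0) (by norm_num)) (div_nonneg hN0 (by norm_num)) le_rfl
      (le_of_eq (by ring)) (le_of_eq (by ring)) (by norm_num) (by norm_num)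
      (by nlinarith [hN0, (Nat.cast_nonneg d : (0 : ℝ) ≤ d)])
    obtain ⟨-, -, -, -, h5, h6, h7⟩ := hX
    have hsum : 5 * (1 : ℝ) * 1 * (KL * ((B₀ * Amaj + 1) * (1 + 2 * 1))) * (((16 * ((d : ℝ) + 1) + 1) * N) / 2 + N / 2) = KB * (cD * N) := by
      rw [hKB, hcD]; ring
    refine ⟨?_, fun ν => ?_, ?_⟩
    · have h := h5 ⟨toTorus (y + shift ℓ ((ℓ + 1) ^ s) c.a c.ρ c.k c.k), τ⟩
      rw [hsum, hlen, hcfinv, WithLp.ofLp_toLp, liftB_apply] at h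
      have hval : (fun w => φ (w - shift ℓ ((ℓ + 1) ^ s) c.a c.ρ c.k c.k))
          (labels (toTorus (hd := hd) (hL := hL) (mV := c.k + 1 + s + e) (KV := 0) (ℓ := ℓ) (y + shift ℓ ((ℓ + 1) ^ s) c.a c.ρ c.k c.k))) τ = φ y τ := by
        simp only [hlab, add_sub_cancel_right]
      exact (le_of_eq (congrArg (fun u => |g u|) hval.symm)).trans h
    · have h := h6 ν ⟨toTorus (y + shift ℓ ((ℓ + 1) ^ s) c.a c.ρ c.k c.k), τ⟩
      rw [hsum, hlen, hcfinv, WithLp.ofLp_toLp, DV_liftB_translate (le_refl (1 : ℤ)) h1N g (shift ℓ ((ℓ + 1) ^ s) c.a c.ρ c.k c.k) hψ1 ν, hlab,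
        add_sub_cancel_right] at h
      exact h
    · have h := h7 ⟨toTorus (y + shift ℓ ((ℓ + 1) ^ s) c.a c.ρ c.k c.k), τ⟩
      rw [hsum, hlen, hcfinv] at h
      have h' : |laplace η⁻¹ (fun z => liftB (hd := hd) (hL := hL) (mV := c.k + 1 + s + e) (KV := 0) (ℓ := ℓ) g
          (fun w => φ (w - shift ℓ ((ℓ + 1) ^ s) c.a c.ρ c.k c.k)) ⟨z, τ⟩) (toTorus (y + shift ℓ ((ℓ + 1) ^ s) c.a c.ρ c.k c.k))| ≤ _ := h
      rw [laplace_liftB_translate (le_refl (1 : ℤ)) h1N g (shift ℓ ((ℓ + 1) ^ s) c.a c.ρ c.k c.k) hψ1 τ, hlab, add_sub_cancel_right] at h'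
      exact h'
  -- ### assemble: real and imaginary parts, and the level slack `j ≤ lev + 1`
  obtain ⟨hr5, hr6, hr7⟩ := key Complex.reLm abs_reLm_le
  obtain ⟨hi5, hi6, hi7⟩ := key Complex.imLm abs_imLm_le
  have hpow : ∀ p : ℕ, p ≤ 3 → (((ℓ : ℝ) + 1) ^ j * η) ^ p ≤ ((ℓ : ℝ) + 1) ^ 3 * ((((ℓ : ℝ) + 1) ^ lev * η) ^ p) := by
    intro p hp
    have h1 : ((ℓ : ℝ) + 1) ^ j * η ≤ ((ℓ : ℝ) + 1) * (((ℓ : ℝ) + 1) ^ lev * η) := by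
      rw [← mul_assoc, ← pow_succ']
      exact mul_le_mul_of_nonneg_right (pow_le_pow_right₀ hLr hjlev) hη.le
    calc (((ℓ : ℝ) + 1) ^ j * η) ^ p ≤ (((ℓ : ℝ) + 1) * (((ℓ : ℝ) + 1) ^ lev * η)) ^ p := pow_le_pow_left₀ (by positivity) h1 p
      _ = ((ℓ : ℝ) + 1) ^ p * ((((ℓ : ℝ) + 1) ^ lev * η) ^ p) := by rw [mul_pow]
      _ ≤ ((ℓ : ℝ) + 1) ^ 3 * ((((ℓ : ℝ) + 1) ^ lev * η) ^ p) := mul_le_mul_of_nonneg_right (pow_le_pow_right₀ hLr hp) (by positivity)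
  have hfin : ∀ (p : ℕ) (F : ℂ), p ≤ 3 → |Complex.reLm F| ≤ KB * (cD * N) * ((((ℓ : ℝ) + 1) ^ lev * η) ^ p)⁻¹ →
      |Complex.imLm F| ≤ KB * (cD * N) * ((((ℓ : ℝ) + 1) ^ lev * η) ^ p)⁻¹ →
      (((ℓ : ℝ) + 1) ^ j * η) ^ p * ‖F‖ ≤ (2 * ((ℓ : ℝ) + 1) ^ 3 * KB * cD + 1) * N := by
    intro p F hp hre him
    have hwp : 0 < (((ℓ : ℝ) + 1) ^ lev * η) ^ p := by positivity
    have hF : ‖F‖ ≤ 2 * (KB * (cD * N)) * ((((ℓ : ℝ) + 1) ^ lev * η) ^ p)⁻¹ := by linarith [norm_le_re_add_im F]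
    calc (((ℓ : ℝ) + 1) ^ j * η) ^ p * ‖F‖
        ≤ (((ℓ : ℝ) + 1) ^ 3 * ((((ℓ : ℝ) + 1) ^ lev * η) ^ p)) * (2 * (KB * (cD * N)) * ((((ℓ : ℝ) + 1) ^ lev * η) ^ p)⁻¹) :=
          mul_le_mul (hpow p hp) hF (norm_nonneg _) (by positivity)
      _ = 2 * ((ℓ : ℝ) + 1) ^ 3 * KB * cD * N * (((((ℓ : ℝ) + 1) ^ lev * η) ^ p) * ((((ℓ : ℝ) + 1) ^ lev * η) ^ p)⁻¹) := by ring
      _ = 2 * ((ℓ : ℝ) + 1) ^ 3 * KB * cD * N := by rw [mul_inv_cancel₀ hwp.ne', mul_one]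
      _ ≤ (2 * ((ℓ : ℝ) + 1) ^ 3 * KB * cD + 1) * N := by nlinarith [hN0]
  refine ⟨?_, fun ν => hfin 2 _ (by norm_num) (hr6 ν) (hi6 ν), hfin 3 _ le_rfl hr7 hi7⟩
  simpa only [pow_one] using hfin 1 (φ y τ) (by norm_num) hr5 hi5

end Main

end Literature.MathematicalPhysics.QuantumFieldTheory.Balaban1983to89.B8Ineq159FlatDentedCubeMemberTransplant
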